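import Summits.PneNP.PneNP.Theses.KarlinRubin
import Summits.PneNP.PneNP.Theorems.KarlinRubinMonotoneBlindFormIter
import Summits.PneNP.PneNP.Theorems.KarlinRubinMonotoneBlindOrCnfNarrow

/-!
# Crux `MonotoneBlind` (stmt-PneNP-18027, route KarlinRubin), line `Sketch`: stub `stub_weakBlindOrCnf`, per-`n` bound (depth-3 route)

Per-`n` half of the stub `stub_weakBlindOrCnf` of line `Sketch` (weak blindness of EVERY polynomial OR
of polynomial-clause monotone CNFs, no quietness): the inequality at one `n`. For `f = ⋁_{i<m} g_i`, `g_i` the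
monotone CNF of the clause family `𝓒 i` (`#(𝓒 i) ≤ M`, `m ≤ M`, `1 ≤ M`, ANY clause widths), a width cut-off `L`,
a vertex cut-off `v₀ > 0` and admissible sub-universe sizes `n ≥ m₁ ≥ m₂ ≥ k ≥ 2` (`m₁, m₂ ≥ v₀`):

  `Pr_{G(n,1/2,k)}[f] ≤ Pr_{G(n,1/2)}[f] + m M 2^{-(L+1)} + swErr v₀ k n [m₁, m₂] M L`     (`orCnf_planted_le`)

where `swErr` is the error of seat 0's depth reduction along a random flag (`…FormIterDefs`, `…FormIter`):
two clique-restriction switching steps (`n → m₁ → m₂`) followed by the narrow-CNF revival count.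

Proof. (1) Drop the clauses with `> L` slots: the accepted set only grows (`setOf_orCnf_subset_filter`), and under
the null law it grows by at most `m M 2^{-(L+1)}` — a newly accepted noise has a DEAD wide clause
(seat 0's `orCnf_narrow_le`). (2) The OR of the narrowed CNFs, wrapped in a one-child AND, is a level-`3`
alternating monotone formula (`swEval_orCnf₃_iff`, `swBnd_orCnf₃`, `swIn_orCnf₃_univ`), so seat 0's depth reduction
`swIter_count_le` bounds the number of pairs `(A, x)` (planted `k`-set, noise) with `f (x ∪ K_A) ∧ ¬ f x` by
`C(n,k) · 2^N · swErr` (`orNarrowCnf_advCount_le`). (3) Planted acceptance `≤` null acceptance `+` the average over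
`A` of `Pr_x[f (x ∪ K_A) ∧ ¬ f x]` (union bound in each fibre of `plantedCliqueDist_toOuterMeasure_eq_sum`;
`planted_le_null_add_of_advCount`, any event).

* `stub_weakBlindOrCnfPerN` — registered helper stub (the per-`n` bound `orCnf_planted_le`, closed form).

Relation to seat 0's landed proof of `stub_weakBlindOrCnf` (`KarlinRubinMonotoneBlindFormOrCnf.lean`, via the
level-`4` encoding with single-slot leaves and THREE switching steps, `ε n = 4/n`): this file is the direct depth-`3`
route (clauses as level-`0` sets, TWO switching steps) with all parameters explicit; with `k = ⌈n^{1/2-δ}⌉`,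
`m₁ = ⌈n^{1-δ/2}⌉`, `m₂ = ⌈n^{1-δ}⌉`, `L = (2c+2)(⌊log₂ n⌋+1)`, `v₀ = ⌊(6c+6)/δ⌋+1` every error term is `O(1/n)`.
The wide-clause step (1) is seat 0's `orCnf_narrow_le` (`KarlinRubinMonotoneBlindOrCnfNarrow.lean`, the landed form of
the helper `stub_weakBlindOrCnfForm`). All `--supports stmt-PneNP-18027`; no definitions.
-/

set_option linter.dupNamespace false -- `Summit.PneNP.PneNP.…` is the layout-mandated namespace

namespace Summit.PneNP.PneNP.Theorems.MonotoneBlind.VertexCover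

open Literature.Computability.Complexity Literature.Probability.RandomGraphs.PlantedClique Filter Finset
open scoped ENNReal Topology Classical

variable {n : ℕ}

/-! ### An OR of CNFs as a level-`3` alternating monotone formula -/

/-- **Semantics of the wrapped OR of CNFs.** The level-`3` formula `AND [ OR_i (AND_{S ∈ 𝓒 i} OR S) ]` (top
polarity AND) holds at `w` iff some CNF `𝓒 i` is satisfied by `w`. [folklore] -/
theorem swEval_orCnf₃_iff {m : ℕ} (𝓒 : Fin m → Finset (Finset (⊤ : SimpleGraph (Fin n)).edgeSet)) (w : EdgeVec n) :
    swEval (2 + 1) false (swForm.node [swForm.node ((List.finRange m).map fun i =>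
        swForm.node (((𝓒 i).toList).map swForm.leaf))] : swForm n (2 + 1)) w ↔
      ∃ i, ∀ S ∈ 𝓒 i, ∃ e ∈ S, w e = true := by
  constructor
  · intro h
    have hG := (swEval_succ_false _ w).1 h _ (List.mem_singleton_self _)
    obtain ⟨g, hg, hgw⟩ := (swEval_succ_true _ w).1 hG
    obtain ⟨i, -, rfl⟩ := List.mem_map.1 hg
    refine ⟨i, fun S hS => ?_⟩
    exact (swEval_zero_true _ w).1
      ((swEval_succ_false _ w).1 hgw (swForm.leaf S) (List.mem_map.2 ⟨S, Finset.mem_toList.2 hS, rfl⟩))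
  · rintro ⟨i, hi⟩
    refine (swEval_succ_false _ w).2 fun g hg => ?_
    rcases List.mem_singleton.1 hg with rfl
    refine (swEval_succ_true _ w).2 ⟨_, List.mem_map.2 ⟨i, List.mem_finRange i, rfl⟩, ?_⟩
    refine (swEval_succ_false _ w).2 fun S hS => ?_
    obtain ⟨S', hS', rfl⟩ := List.mem_map.1 hS
    exact (swEval_zero_true _ w).2 (hi S' (Finset.mem_toList.1 hS'))

/-- **Fan-ins of the wrapped OR of CNFs**: with `1 ≤ M`, `m ≤ M`, `#(𝓒 i) ≤ M` and clauses of `≤ L` slots the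
formula has fan-ins `≤ M` and level-`0` sets of `≤ L` slots. [folklore] -/
theorem swBnd_orCnf₃ {m M L : ℕ} (𝓒 : Fin m → Finset (Finset (⊤ : SimpleGraph (Fin n)).edgeSet))
    (h1 : 1 ≤ M) (hm : m ≤ M) (hM : ∀ i, #(𝓒 i) ≤ M) (hL : ∀ i, ∀ S ∈ 𝓒 i, #S ≤ L) :
    swBnd M L (2 + 1) (swForm.node [swForm.node ((List.finRange m).map fun i =>
        swForm.node (((𝓒 i).toList).map swForm.leaf))] : swForm n (2 + 1)) := by
  refine (swBnd_succ M L _).2 ⟨?_, fun g hg => ?_⟩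
  · show [_].length ≤ M
    rw [List.length_singleton]
    exact h1
  · rcases List.mem_singleton.1 hg with rfl
    refine (swBnd_succ M L _).2 ⟨?_, fun g' hg' => ?_⟩
    · show (List.map _ (List.finRange m)).length ≤ M
      rw [List.length_map, List.length_finRange]
      exact hm
    · obtain ⟨i, -, rfl⟩ := List.mem_map.1 hg'
      refine (swBnd_succ M L _).2 ⟨?_, fun S hS => ?_⟩
      · show (List.map _ (𝓒 i).toList).length ≤ M
        rw [List.length_map, Finset.length_toList]
        exact hM i
      · obtain ⟨S', hS', rfl⟩ := List.mem_map.1 hS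
        exact (swBnd_zero M L _).2 (hL i S' (Finset.mem_toList.1 hS'))

/-- The wrapped OR of CNFs lies inside the whole vertex set. [folklore] -/
theorem swIn_orCnf₃_univ {m : ℕ} (𝓒 : Fin m → Finset (Finset (⊤ : SimpleGraph (Fin n)).edgeSet)) :
    swIn (univ : Finset (Fin n)) (2 + 1) (swForm.node [swForm.node ((List.finRange m).map fun i =>
        swForm.node (((𝓒 i).toList).map swForm.leaf))] : swForm n (2 + 1)) := by
  refine (swIn_succ _ _).2 fun g _ => (swIn_succ _ _).2 fun g' _ => (swIn_succ _ _).2 fun S _ => ?_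
  exact (swIn_zero _ _).2 fun e _ v _ => mem_univ v

/-! ### The advantage count of a narrow OR of CNFs -/

/-- **Advantage count (narrow clauses).** For `m ≤ M` clause families with `≤ M` clauses of `≤ L` slots each
(`1 ≤ M`), `0 < v₀` and admissible sizes `swSizeOK v₀ k n [m₁, m₂]`: the pairs `(A, x)` (`A` a `k`-subset of
`Fin n`, `x` a noise) with `f (plant A x) ∧ ¬ f x`, `f` the OR of the CNFs, number at most
`C(n,k) · 2^N · swErr v₀ k n [m₁, m₂] M L` — seat 0's `swIter_count_le` for the wrapped formula. [folklore] -/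
theorem orNarrowCnf_advCount_le {k v₀ m₁ m₂ m M L : ℕ} (hv₀ : 0 < v₀)
    (𝓒 : Fin m → Finset (Finset (⊤ : SimpleGraph (Fin n)).edgeSet))
    (h1 : 1 ≤ M) (hm : m ≤ M) (hM : ∀ i, #(𝓒 i) ≤ M) (hL : ∀ i, ∀ S ∈ 𝓒 i, #S ≤ L)
    (hsz : swSizeOK v₀ k n [m₁, m₂]) :
    ((∑ A ∈ powersetCard k (univ : Finset (Fin n)), #(univ.filter fun x : EdgeVec n =>
        (∃ i, ∀ S ∈ 𝓒 i, ∃ e ∈ S, plant A x e = true) ∧ ¬ ∃ i, ∀ S ∈ 𝓒 i, ∃ e ∈ S, x e = true) : ℕ) : ℝ≥0∞) ≤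
      ((n.choose k : ℕ) : ℝ≥0∞) * (((2 ^ Fintype.card (⊤ : SimpleGraph (Fin n)).edgeSet : ℕ) : ℝ≥0∞)) *
        swErr v₀ k n [m₁, m₂] M L := by
  have hsz' : swSizeOK v₀ k #(univ : Finset (Fin n)) [m₁, m₂] := by rwa [card_univ, Fintype.card_fin]
  have h := swIter_count_le v₀ k hv₀ 2 [m₁, m₂] rfl (univ : Finset (Fin n))
    (swForm.node [swForm.node ((List.finRange m).map fun i =>
        swForm.node (((𝓒 i).toList).map swForm.leaf))] : swForm n (2 + 1)) M L
    (swIn_orCnf₃_univ 𝓒) (swBnd_orCnf₃ 𝓒 h1 hm hM hL) hsz'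
  rw [card_univ, Fintype.card_fin] at h
  refine le_of_eq_of_le ?_ h
  congr 1
  refine sum_congr rfl fun A _ => ?_
  congr 1
  ext x
  simp only [mem_filter, mem_univ, true_and, swEval_orCnf₃_iff]

/-! ### From the advantage count to the planted law -/

/-- **Planted `≤` null `+` advantage** (any event). If the pairs `(A, x)` with `P (plant A x) ∧ ¬ P x` lie in
sets `T A` with `Σ_A #(T A) ≤ C(n,k) · 2^N · B` (`k ≤ n`), then `Pr_{G(n,1/2,k)}[P] ≤ Pr_{G(n,1/2)}[P] + B`:
fibre the planted law over `A` (`plantedCliqueDist_toOuterMeasure_eq_sum`), bound each fibre by the union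
`{P} ∪ {P ∘ plant A ∧ ¬ P}`, and average. [folklore] -/
theorem planted_le_null_add_of_advCount {k : ℕ} (hk : k ≤ n) (P : EdgeVec n → Prop) (B : ℝ≥0∞)
    (T : Finset (Fin n) → Finset (EdgeVec n)) (hT : ∀ A x, P (plant A x) → ¬ P x → x ∈ T A)
    (h : ((∑ A ∈ powersetCard k (univ : Finset (Fin n)), #(T A) : ℕ) : ℝ≥0∞) ≤
      ((n.choose k : ℕ) : ℝ≥0∞) * (((2 ^ Fintype.card (⊤ : SimpleGraph (Fin n)).edgeSet : ℕ) : ℝ≥0∞)) * B) :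
    (plantedCliqueDist n k).toOuterMeasure {x | P x} ≤ (erdosRenyiHalf n).toOuterMeasure {x | P x} + B := by
  set KS := kSubsets n k with hKS
  set P0 := erdosRenyiHalf n with hP0
  set N := Fintype.card (⊤ : SimpleGraph (Fin n)).edgeSet with hN
  have hKS' : KS = powersetCard k (univ : Finset (Fin n)) := by rw [hKS, kSubsets, min_eq_left hk]
  have hcardKS : #KS = n.choose k := by rw [hKS', card_powersetCard, card_univ, Fintype.card_fin]
  have hne : ((#KS : ℕ) : ℝ≥0∞) ≠ 0 := card_kSubsets_cast_ne_zero n k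
  have htop : ((#KS : ℕ) : ℝ≥0∞) ≠ ⊤ := ENNReal.natCast_ne_top _
  have hcardE : Fintype.card (EdgeVec n) = 2 ^ N := by simp [EdgeVec, hN]
  have h2 : ((2 ^ N : ℕ) : ℝ≥0∞) ≠ 0 := by exact_mod_cast (Nat.two_pow_pos N).ne'
  have h2top : ((2 ^ N : ℕ) : ℝ≥0∞) ≠ ⊤ := ENNReal.natCast_ne_top _
  -- per planted set: the union bound, and the advantage fibre as a count
  have hA : ∀ A, P0.toOuterMeasure {x | plant A x ∈ {x : EdgeVec n | P x}} ≤
      P0.toOuterMeasure {x | P x} + ((#(T A) : ℕ) : ℝ≥0∞) * (((2 ^ N : ℕ) : ℝ≥0∞))⁻¹ := by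
    intro A
    have hadv : P0.toOuterMeasure {x | P (plant A x) ∧ ¬ P x} ≤ ((#(T A) : ℕ) : ℝ≥0∞) * (((2 ^ N : ℕ) : ℝ≥0∞))⁻¹ := by
      rw [hP0, erdosRenyiHalf_toOuterMeasure_eq_card_div, hcardE, div_eq_mul_inv]
      gcongr
      intro x hx
      rw [mem_filter] at hx
      exact hT A x hx.2.1 hx.2.2
    refine le_trans (P0.toOuterMeasure.mono fun x hx => ?_) ((MeasureTheory.measure_union_le _ _).trans
      (add_le_add le_rfl hadv))
    by_cases hPx : P x
    · exact Or.inl hPx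
    · exact Or.inr ⟨hx, hPx⟩
  rw [plantedCliqueDist_toOuterMeasure_eq_sum]
  calc ((#KS : ℕ) : ℝ≥0∞)⁻¹ * ∑ A ∈ KS, P0.toOuterMeasure {x | plant A x ∈ {x : EdgeVec n | P x}}
      ≤ ((#KS : ℕ) : ℝ≥0∞)⁻¹ * ∑ A ∈ KS,
          (P0.toOuterMeasure {x | P x} + ((#(T A) : ℕ) : ℝ≥0∞) * (((2 ^ N : ℕ) : ℝ≥0∞))⁻¹) := by
        gcongr with A hA'
        exact hA A
    _ = P0.toOuterMeasure {x | P x} +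
          ((#KS : ℕ) : ℝ≥0∞)⁻¹ * (((∑ A ∈ KS, #(T A) : ℕ) : ℝ≥0∞) * (((2 ^ N : ℕ) : ℝ≥0∞))⁻¹) := by
        rw [sum_add_distrib, sum_const, nsmul_eq_mul, mul_add, ← mul_assoc, ENNReal.inv_mul_cancel hne htop,
          one_mul, ← sum_mul, Nat.cast_sum]
    _ ≤ P0.toOuterMeasure {x | P x} + ((#KS : ℕ) : ℝ≥0∞)⁻¹ *
          ((((n.choose k : ℕ) : ℝ≥0∞) * (((2 ^ N : ℕ) : ℝ≥0∞)) * B) * (((2 ^ N : ℕ) : ℝ≥0∞))⁻¹) := by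
        have h' : (((∑ A ∈ KS, #(T A) : ℕ)) : ℝ≥0∞) ≤
            ((n.choose k : ℕ) : ℝ≥0∞) * (((2 ^ N : ℕ) : ℝ≥0∞)) * B := by rw [hKS']; exact h
        exact add_le_add le_rfl (mul_le_mul_right (mul_le_mul_left h' _) _)
    _ = P0.toOuterMeasure {x | P x} + (((#KS : ℕ) : ℝ≥0∞)⁻¹ * ((n.choose k : ℕ) : ℝ≥0∞)) *
          (((2 ^ N : ℕ) : ℝ≥0∞) * (((2 ^ N : ℕ) : ℝ≥0∞))⁻¹) * B := by ring
    _ = P0.toOuterMeasure {x | P x} + B := by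
        rw [← hcardKS, ENNReal.inv_mul_cancel hne htop, ENNReal.mul_inv_cancel h2 h2top, one_mul, one_mul]

/-- **Planted bound for a narrow OR of CNFs (per `n`).** Under the hypotheses of `orNarrowCnf_advCount_le`:
`Pr_{G(n,1/2,k)}[∃ i, g_i] ≤ Pr_{G(n,1/2)}[∃ i, g_i] + swErr v₀ k n [m₁, m₂] M L`. [folklore] -/
theorem orNarrowCnf_planted_le {k v₀ m₁ m₂ m M L : ℕ} (hv₀ : 0 < v₀)
    (𝓒 : Fin m → Finset (Finset (⊤ : SimpleGraph (Fin n)).edgeSet))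
    (h1 : 1 ≤ M) (hm : m ≤ M) (hM : ∀ i, #(𝓒 i) ≤ M) (hL : ∀ i, ∀ S ∈ 𝓒 i, #S ≤ L)
    (hsz : swSizeOK v₀ k n [m₁, m₂]) :
    (plantedCliqueDist n k).toOuterMeasure {x | ∃ i, ∀ S ∈ 𝓒 i, ∃ e ∈ S, x e = true} ≤
      (erdosRenyiHalf n).toOuterMeasure {x | ∃ i, ∀ S ∈ 𝓒 i, ∃ e ∈ S, x e = true} +
        swErr v₀ k n [m₁, m₂] M L := by
  have hcount := orNarrowCnf_advCount_le hv₀ 𝓒 h1 hm hM hL hsz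
  refine planted_le_null_add_of_advCount (k_le_of_swSizeOK v₀ k [m₁, m₂] n hsz).2
    (fun x => ∃ i, ∀ S ∈ 𝓒 i, ∃ e ∈ S, x e = true) (swErr v₀ k n [m₁, m₂] M L)
    (fun A => univ.filter fun x : EdgeVec n =>
      (∃ i, ∀ S ∈ 𝓒 i, ∃ e ∈ S, plant A x e = true) ∧ ¬ ∃ i, ∀ S ∈ 𝓒 i, ∃ e ∈ S, x e = true)
    (fun A x h₁ h₂ => mem_filter.2 ⟨mem_univ _, h₁, h₂⟩) hcount

/-! ### Dropping the wide clauses -/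

/-- Dropping clauses only enlarges the accepted set of an OR of CNFs. [folklore] -/
theorem setOf_orCnf_subset_filter {m : ℕ} (𝓒 : Fin m → Finset (Finset (⊤ : SimpleGraph (Fin n)).edgeSet))
    (L : ℕ) :
    {x : EdgeVec n | ∃ i, ∀ S ∈ 𝓒 i, ∃ e ∈ S, x e = true} ⊆
      {x | ∃ i, ∀ S ∈ (𝓒 i).filter (fun S => #S ≤ L), ∃ e ∈ S, x e = true} := by
  rintro x ⟨i, hi⟩
  exact ⟨i, fun S hS => hi S (mem_filter.1 hS).1⟩

/-! ### The per-`n` bound -/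

/-- **Planted bound for an OR of CNFs of any widths (per `n`).** For `m ≤ M` clause families with `≤ M` clauses
each (`1 ≤ M`), a width cut-off `L`, `0 < v₀` and admissible sizes `swSizeOK v₀ k n [m₁, m₂]`:
`Pr_{G(n,1/2,k)}[∃ i, g_i] ≤ Pr_{G(n,1/2)}[∃ i, g_i] + m M 2^{-(L+1)} + swErr v₀ k n [m₁, m₂] M L` — narrow the
clauses (`setOf_orCnf_subset_filter`, seat 0's `orCnf_narrow_le`) and apply `orNarrowCnf_planted_le`.
[folklore] -/
theorem orCnf_planted_le {k v₀ m₁ m₂ m M : ℕ} (L : ℕ) (hv₀ : 0 < v₀)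
    (𝓒 : Fin m → Finset (Finset (⊤ : SimpleGraph (Fin n)).edgeSet))
    (h1 : 1 ≤ M) (hm : m ≤ M) (hM : ∀ i, #(𝓒 i) ≤ M) (hsz : swSizeOK v₀ k n [m₁, m₂]) :
    (plantedCliqueDist n k).toOuterMeasure {x | ∃ i, ∀ S ∈ 𝓒 i, ∃ e ∈ S, x e = true} ≤
      (erdosRenyiHalf n).toOuterMeasure {x | ∃ i, ∀ S ∈ 𝓒 i, ∃ e ∈ S, x e = true} +
        ((m * M : ℕ) : ℝ≥0∞) * 2⁻¹ ^ (L + 1) + swErr v₀ k n [m₁, m₂] M L := by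
  have hnarrow := orNarrowCnf_planted_le hv₀ (fun i => (𝓒 i).filter fun S => #S ≤ L) h1 hm
    (fun i => (card_le_card (filter_subset _ _)).trans (hM i)) (fun i S hS => (mem_filter.1 hS).2) hsz
  calc (plantedCliqueDist n k).toOuterMeasure {x | ∃ i, ∀ S ∈ 𝓒 i, ∃ e ∈ S, x e = true}
      ≤ (plantedCliqueDist n k).toOuterMeasure
          {x | ∃ i, ∀ S ∈ (𝓒 i).filter (fun S => #S ≤ L), ∃ e ∈ S, x e = true} :=
        (plantedCliqueDist n k).toOuterMeasure.mono (setOf_orCnf_subset_filter 𝓒 L)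
    _ ≤ (erdosRenyiHalf n).toOuterMeasure {x | ∃ i, ∀ S ∈ (𝓒 i).filter (fun S => #S ≤ L), ∃ e ∈ S, x e = true} +
          swErr v₀ k n [m₁, m₂] M L := hnarrow
    _ ≤ (erdosRenyiHalf n).toOuterMeasure {x | ∃ i, ∀ S ∈ 𝓒 i, ∃ e ∈ S, x e = true} +
          ((m * M : ℕ) : ℝ≥0∞) * 2⁻¹ ^ (L + 1) + swErr v₀ k n [m₁, m₂] M L :=
        add_le_add (orCnf_narrow_le m M L 𝓒 hM) le_rfl

/-! ### Registered form -/

/-- **stub_weakBlindOrCnfPerN** (registered helper stub of `stub_weakBlindOrCnf`, crux stmt-PneNP-18027, line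
`Sketch`): the per-`n` planted bound for an OR of CNFs of any widths, `orCnf_planted_le`, with seat 0's
`swSizeOK` / `swErr` spelled by their full names. [folklore] -/
theorem stub_weakBlindOrCnfPerN : ∀ (n k v₀ m₁ m₂ m M L : ℕ) (𝓒 : Fin m → Finset (Finset ((⊤ : SimpleGraph (Fin n)).edgeSet))), 0 < v₀ → 1 ≤ M → m ≤ M → (∀ i, #(𝓒 i) ≤ M) → Summit.PneNP.PneNP.Theorems.swSizeOK v₀ k n [m₁, m₂] → (plantedCliqueDist n k).toOuterMeasure {x | ∃ i, ∀ S ∈ 𝓒 i, ∃ e ∈ S, x e = true} ≤ (erdosRenyiHalf n).toOuterMeasure {x | ∃ i, ∀ S ∈ 𝓒 i, ∃ e ∈ S, x e = true} + ((m * M : ℕ) : ℝ≥0∞) * 2⁻¹ ^ (L + 1) + Summit.PneNP.PneNP.Theorems.swErr v₀ k n [m₁, m₂] M L :=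
  fun _ _ _ _ _ _ _ L 𝓒 hv₀ h1 hm hM hsz => orCnf_planted_le L hv₀ 𝓒 h1 hm hM hsz

end Summit.PneNP.PneNP.Theorems.MonotoneBlind.VertexCover
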